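import Literature.NumberTheory.ModularSymbols.FullLevelHomologyHeckeChain
import HarnessLib

/-!
# `T_q` on `H₁(Γ₀(M), k[GL₂(ℤ/p)])` commutes with the `GL₂(ℤ/p)`-action and preserves invariants

Topic `Literature/NumberTheory/ModularSymbols`; namespace `Literature.NumberTheory.ModularSymbols.FullLevel`; sequel of
`FullLevelHomologyHeckeChain` (`heckeChain`, `heckeT`).  Proved theorems + one definition; no named fact, no `sorry`.

* `coeffAct_rightTranslation` (left and right translations on `k[GL₂(ℤ/p)]` commute), `heckeChain_mapRange`
  (`T_q ∘ R_g = R_g ∘ T_q` on chains), `H1carrierRep_H1π`, and **`heckeT_H1carrierRep`**: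
  `T_q (g·z) = g·(T_q z)` on `H₁(Γ₀(M), k[GL₂(ℤ/p)])` — Hecke operators at `q ∤ pM` commute with the level structure at `p`.
* `heckeT_mem_H1Invariants`, **`heckeTInvariants k p M hq hqp H`**: `T_q` restricted to `H₁(Γ₀(M), k[GL₂(ℤ/p)])^H` for any
  `H ≤ GL₂(ℤ/p)` — for `H = T̃` the upstairs Hecke operator of the K-line's dictionary
  `H₁(Y(K(p)K₀(M)))^{T̃} ≃ H₁(Γ₀(p²M))` (route BSD/TeichmullerTwistDescent; comparison with downstairs `T_q` not here).

## References
* A. Ash, G. Stevens, Duke Math. J. 53 (1986), §1 (1.2)–(1.4). [AshStevens1986]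
* G. Shimura, *Introduction to the arithmetic theory of automorphic functions* (1971), §8.3. [Shimura1971]
-/

noncomputable section

namespace Literature.NumberTheory.ModularSymbols

namespace FullLevel

open scoped MatrixGroups
open CategoryTheory CongruenceSubgroup groupHomology Finsupp Matrix
open Literature.Algebra.Homology
open Literature.NumberTheory.EllipticCurves.ModularForms

variable (k : Type) [CommRing k] (p M : ℕ)

/-! ### `T_q` commutes with the `GL₂(ℤ/p)`-action -/

/-- Right translation on coefficients is `lmapDomain (· * g⁻¹)`. [cite: AshStevens1986, §1 (1.2)] -/
theorem rightTranslation_hom_apply (g : GL (Fin 2) (ZMod p)) (f : coeff k p M) :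
    (PermutationCoeff.rightTranslation (k := k) (redGL p M) g).hom f = Finsupp.lmapDomain k k (· * g⁻¹) f := rfl

/-- Left and right translations commute on `k[GL₂(ℤ/p)]`. [cite: AshStevens1986, §1 (1.2)] -/
theorem coeffAct_rightTranslation (g' g : GL (Fin 2) (ZMod p)) (f : coeff k p M) :
    coeffAct k p M g' ((PermutationCoeff.rightTranslation (k := k) (redGL p M) g).hom f) =
      (PermutationCoeff.rightTranslation (k := k) (redGL p M) g).hom (coeffAct k p M g' f) := by
  rw [rightTranslation_hom_apply, rightTranslation_hom_apply, coeffAct]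
  simp only [lmapDomain_apply, ← Finsupp.mapDomain_comp]
  congr 1
  funext x
  simp [mul_assoc]

/-- The `GL₂(ℤ/p)`-action on classes: `g · [c] = [R_g c]` with `R_g` applied coefficientwise. [cite: AshStevens1986, §1 (1.2)] -/
theorem H1carrierRep_H1π (g : GL (Fin 2) (ZMod p)) (c : cycles₁ (coeff k p M)) :
    H1carrierRep k p M g (H1π _ c) =
      H1π _ (mapCycles₁ (MonoidHom.id _) (PermutationCoeff.rightTranslation (redGL p M) g) c) := by
  rw [H1carrierRep, PermutationCoeff.H1RightRep_apply]
  exact groupHomology.H1π_comp_map_apply (A := coeff k p M) (B := coeff k p M) (MonoidHom.id _)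
    (PermutationCoeff.rightTranslation (redGL p M) g) c

/-- The chain underlying `R_g c` is `mapRange R_g c`. [cite: AshStevens1986, §1 (1.2)] -/
theorem coe_mapCycles₁_rightTranslation (g : GL (Fin 2) (ZMod p)) (c : cycles₁ (coeff k p M)) :
    (mapCycles₁ (MonoidHom.id _) (PermutationCoeff.rightTranslation (redGL p M) g) c).1 =
      mapRange.linearMap (PermutationCoeff.rightTranslation (k := k) (redGL p M) g).hom.toLinearMap c.1 := by
  rw [coe_mapCycles₁]
  simp only [ModuleCat.hom_ofHom, LinearMap.coe_comp, Function.comp_apply, lmapDomain_apply, MonoidHom.coe_id,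
    mapDomain_id]

variable [Fact p.Prime] {q : ℕ} [NeZero q] (hq : q.Prime) (hqp : q ≠ p)

/-- **`T_q` commutes with right translation on chains.** [cite: AshStevens1986, §1 (1.2), (1.4)] -/
theorem heckeChain_mapRange (g : GL (Fin 2) (ZMod p)) (c : Gamma0 M →₀ coeff k p M) :
    heckeChain k p M hq hqp
        (mapRange.linearMap (PermutationCoeff.rightTranslation (k := k) (redGL p M) g).hom.toLinearMap c) =
      mapRange.linearMap (PermutationCoeff.rightTranslation (k := k) (redGL p M) g).hom.toLinearMap
        (heckeChain k p M hq hqp c) := by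
  induction c using Finsupp.induction_linear with
  | zero => simp
  | add c₁ c₂ h₁ h₂ => rw [map_add, map_add, h₁, h₂, map_add, map_add]
  | single γ f =>
    rw [mapRange.linearMap_apply, mapRange_single, heckeChain_single, heckeChain_single, map_sum]
    refine Finset.sum_congr rfl (fun i _ => ?_)
    rw [mapRange.linearMap_apply, mapRange_single]
    congr 1
    exact coeffAct_rightTranslation k p M _ g f

/-- **`T_q` commutes with the `GL₂(ℤ/p)`-action on `H₁(Γ₀(M), k[GL₂(ℤ/p)])`.** [cite: AshStevens1986, §1 (1.4)] -/
theorem heckeT_H1carrierRep (g : GL (Fin 2) (ZMod p)) (z : H1carrier k p M) :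
    heckeT k p M hq hqp (H1carrierRep k p M g z) = H1carrierRep k p M g (heckeT k p M hq hqp z) := by
  induction z using H1_induction_on with
  | h c =>
    rw [H1carrierRep_H1π, heckeT_H1π, heckeT_H1π, H1carrierRep_H1π]
    congr 1
    apply Subtype.ext
    show heckeChain k p M hq hqp (mapCycles₁ _ _ c).1 =
      (mapCycles₁ (MonoidHom.id _) (PermutationCoeff.rightTranslation (redGL p M) g)
        ⟨heckeChain k p M hq hqp c.1, heckeChain_mem_cycles₁ k p M hq hqp c.1 c.2⟩).1
    rw [coe_mapCycles₁_rightTranslation, coe_mapCycles₁_rightTranslation]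
    exact heckeChain_mapRange k p M hq hqp g c.1

/-- `T_q` preserves the `T̃`-invariants (indeed the invariants of any subgroup). [cite: AshStevens1986, §1 (1.4)] -/
theorem heckeT_mem_H1Invariants (H : Subgroup (GL (Fin 2) (ZMod p))) {z : H1carrier k p M}
    (hz : z ∈ PermutationCoeff.H1Invariants k (redGL p M) H) :
    heckeT k p M hq hqp z ∈ PermutationCoeff.H1Invariants k (redGL p M) H := by
  rw [PermutationCoeff.mem_H1Invariants_iff] at hz ⊢
  intro h
  have := heckeT_H1carrierRep k p M hq hqp (h : GL (Fin 2) (ZMod p)) z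
  rw [H1carrierRep] at this
  rw [← this, hz h]

/-- **`T_q` restricted to the torus invariants** `H₁(Γ₀(M), k[GL₂(ℤ/p)])^{T̃}` (the upstairs Hecke operator of the
K-line's step (S2)). [cite: AshStevens1986, §1 (1.4)] -/
def heckeTInvariants (H : Subgroup (GL (Fin 2) (ZMod p))) :
    PermutationCoeff.H1Invariants k (redGL p M) H →ₗ[k] PermutationCoeff.H1Invariants k (redGL p M) H :=
  (heckeT k p M hq hqp).restrict (fun _ hz => heckeT_mem_H1Invariants k p M hq hqp H hz)

/-- Unfolding `heckeTInvariants`. [cite: AshStevens1986, §1 (1.4)] -/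
theorem coe_heckeTInvariants (H : Subgroup (GL (Fin 2) (ZMod p))) (z : PermutationCoeff.H1Invariants k (redGL p M) H) :
    (heckeTInvariants k p M hq hqp H z : H1carrier k p M) = heckeT k p M hq hqp z := rfl

end FullLevel

end Literature.NumberTheory.ModularSymbols
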